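import Summits.RiemannHypothesis.RiemannHypothesis.Theorems.Splittings.LiOneSidedCriteria
import Summits.RiemannHypothesis.RiemannHypothesis.Theorems.Splittings.LiSignPatterns
import Literature.NumberTheory.LFunctions.EquivalentsKeiperLiProofs
import Literature.NumberTheory.LFunctions.LiCriterion
import Literature.NumberTheory.LFunctions.KeiperLiAsymptoticCriteria
import HarnessLib

/-!
# The SECOND-ORDER Li law and the curvature criterion `E_li^(2)`: `RH ⟺ |λ_{n+2} − 2λ_{n+1} + λ_n| ≤ 2λ₁ (n ≥ 1)`
# (li-bridge g6 §§0–3, zero definitions; Xiao 2020 Cor. 3.3 first typing + converse + RH-free gap theorem)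

Cell rh-split, seat rh-split-li-bridge g6 (brief sha16 f79c5f09d8bcb036), card `run/shared/lean/pub/rh-split/cards/SPLIT-li-bridge.md` §13;
§§0–3 of `HOME/rh-split-li-bridge/SketchG6.lean` sha16 ed64da7a8eb46ca1 (referee rh-split-ref g3 REPLAY PASS + LABELS 2026-08-27T05:44:52Z,
card block 06:17:36Z; lead rh-split-lead g3 RULING #26 (xi)(a): «ZERO-DEF where cheap — spell out liSecondDiff / liIncr / boxSum»);
filed by rh-split-typer-2 g4.  DELTA vs the scratch: the three data abbreviations are SPELLED OUT everywhere
(`liSecondDiff n` ↦ `keiperLiCoeff (n+2) − 2·keiperLiCoeff (n+1) + keiperLiCoeff n`, `liIncr n` ↦ `keiperLiCoeff (n+1) − keiperLiCoeff n`,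
`boxSum n T` ↦ the `Finset` box sum `Σ_{ρ ∈ liZeroBox T} m(ρ)(1 − (1 − 1/ρ)ⁿ)` over `(liZeroBox_finite T).toFinset`), the `simp only [defs]`
steps dropped accordingly; theorem names and proofs otherwise verbatim; namespace `…Splittings.LiSecondOrderCriterion` (scratch `RhSplit.LiBridgeG6`).

* §0 `boxSum_eq_finsum`, `tendsto_boxSum` — the Bombieri–Lagarias box sums `Λ_n(T) → λ_n` (tree `keiperLiCoeff_eq_zero_sum_holds`);
* §1 `abs_liSecondDiff_le_of_rh : RH → ∀ n ≥ 1, |λ_{n+2} − 2λ_{n+1} + λ_n| ≤ 2λ₁` — PRINT = Xiao 2020, arXiv:2006.13103, Cor. 3.3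
  [corpus:paper:arxiv-2006.13103 p0005 L87–118], FIRST TYPING (box-sum proof as printed: the second difference of `Λ_n(T)` is
  `−Σ m(1−1/ρ)ⁿ/ρ²`, under RH `|1−1/ρ| = 1` and `1/|ρ|² = 2 Re(1/ρ) ≤ 2 Re Λ₁(T) ↑ λ₁`); `two_mul_keiperLiCoeff_one : 2λ₁ = 2 + γ − log 4π`;
* §2 `rh_of_liSecondDiffFloor` (one-sided sub-exponential floor on `±d_n` ⟹ RH, double telescoping onto the tree's `rh_of_liIncrFloor`),
  `rh_iff_abs_liSecondDiff_le` (the curvature criterion `E_li^(2)`, an RH-EQUIVALENCE), `rh_iff_liSecondDiff_bddBelow/Above`, and the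
  RH-FREE gap theorem `liSecondDiff_dichotomy` (`|d_n| ≤ 2λ₁ ∀ n ≥ 1`, OR `d_n` unbounded below AND above);
* §3 `abs_liIncr_sub_liIncr_le_of_rh` (under RH the increments are `2λ₁`-Lipschitz), `liIncr_le_of_exception`.

LABELS (referee g3 05:44:52Z / 06:17:36Z): §1 PRINT first typing (RH-implied); §2 `rh_iff_abs_liSecondDiff_le` RH-EQUIVALENT kernel,
RELABELLING-grade as a conjunct (CANDIDATES C12 row `E_li^(2)`), `liSecondDiff_dichotomy` RH-FREE; §3 RH-implied structure; class
(li, bridge) UNCHANGED (barrier note).  `RiemannHypothesis` below is the summit's `Summit.RiemannHypothesis` where so written.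

HONEST LABEL: «SPLITTING SEARCH over kernel-typed RH-EQUIVALENCES; a splitting A ∧ B ⟹ RH is CONDITIONAL bookkeeping unless A and B are
both proved; nothing here bears on the truth of RH.»
-/

set_option linter.dupNamespace false

noncomputable section

open Complex Filter Topology Finset
open scoped Real ComplexConjugate

namespace Summit.RiemannHypothesis.RiemannHypothesis.Theorems.Splittings.LiSecondOrderCriterion

open Literature.NumberTheory.LFunctions
open Summit.RiemannHypothesis.RiemannHypothesis.Theorems.Splittings
open Summit.RiemannHypothesis.RiemannHypothesis.Theorems.Splittings.LiOneSidedCriteria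

/-! ## §0 Objects -/

/-- `d_n = Δ_{n+1} − Δ_n`: the second difference is the difference of consecutive increments. -/
theorem liSecondDiff_eq_liIncr_sub (n : ℕ) :
    (keiperLiCoeff (n + 2) - 2 * keiperLiCoeff (n + 1) + keiperLiCoeff n) =
      (keiperLiCoeff (n + 1 + 1) - keiperLiCoeff (n + 1)) - (keiperLiCoeff (n + 1) - keiperLiCoeff n) := by
  ring

/-- The `Finset` box sum over `(liZeroBox_finite T).toFinset` is the tree's `finsum` over `liZeroBox T`. -/
theorem boxSum_eq_finsum (n : ℕ) (T : ℝ) :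
    (∑ ρ ∈ (liZeroBox_finite T).toFinset, (riemannZetaZeroOrder ρ : ℂ) * (1 - (1 - 1 / ρ) ^ n))
        = ∑ᶠ ρ ∈ liZeroBox T, (riemannZetaZeroOrder ρ : ℂ) * (1 - (1 - 1 / ρ) ^ n) := by
  rw [finsum_mem_eq_finite_toFinset_sum _ (liZeroBox_finite T)]

/-- `Λ_n(T) → λ_n` (`keiperLiCoeff_eq_zero_sum_holds`, Li 1997 (1.4) / Bombieri–Lagarias (1.2)). -/
theorem tendsto_boxSum {n : ℕ} (hn : 1 ≤ n) :
    Tendsto (fun T : ℝ ↦ (∑ ρ ∈ (liZeroBox_finite T).toFinset, (riemannZetaZeroOrder ρ : ℂ) * (1 - (1 - 1 / ρ) ^ n))) atTop (𝓝 (keiperLiCoeff n : ℂ)) := by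
  have h : (fun T : ℝ ↦ (∑ ρ ∈ (liZeroBox_finite T).toFinset, (riemannZetaZeroOrder ρ : ℂ) * (1 - (1 - 1 / ρ) ^ n)))
      = fun T : ℝ ↦ ∑ᶠ ρ ∈ liZeroBox T, (riemannZetaZeroOrder ρ : ℂ) * (1 - (1 - 1 / ρ) ^ n) :=
    funext (boxSum_eq_finsum n)
  rw [h]
  exact keiperLiCoeff_eq_zero_sum_holds n hn

/-! ## §1 RH ⟹ |d_n| ≤ 2λ₁ (Xiao 2020, Cor. 3.3) -/

/-- Second difference of the box sums: `Λ_{n+2} − 2Λ_{n+1} + Λ_n = −Σ m(ρ)(1 − 1/ρ)ⁿ/ρ²`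
(Xiao 2020, Thm. 3.2, box form). -/
theorem boxSum_secondDiff (n : ℕ) (T : ℝ) :
    (∑ ρ ∈ (liZeroBox_finite T).toFinset, (riemannZetaZeroOrder ρ : ℂ) * (1 - (1 - 1 / ρ) ^ (n + 2)))
        - 2 * (∑ ρ ∈ (liZeroBox_finite T).toFinset, (riemannZetaZeroOrder ρ : ℂ) * (1 - (1 - 1 / ρ) ^ (n + 1)))
        + (∑ ρ ∈ (liZeroBox_finite T).toFinset, (riemannZetaZeroOrder ρ : ℂ) * (1 - (1 - 1 / ρ) ^ n))
      = -∑ ρ ∈ (liZeroBox_finite T).toFinset,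
          (riemannZetaZeroOrder ρ : ℂ) * (1 - 1 / ρ) ^ n / ρ ^ 2 := by
  rw [Finset.mul_sum, ← Finset.sum_sub_distrib, ← Finset.sum_add_distrib, ← Finset.sum_neg_distrib]
  refine Finset.sum_congr rfl fun ρ _ ↦ ?_
  ring

/-- Zeros in the Bombieri–Lagarias box lie on the critical line under RH. -/
theorem re_eq_half_of_mem_liZeroBox (hRH : RiemannHypothesis) {T : ℝ} {ρ : ℂ}
    (hρ : ρ ∈ liZeroBox T) : ρ.re = 1 / 2 := by
  obtain ⟨hz, -, -, him, -⟩ := hρ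
  have him0 : ρ.im ≠ 0 := abs_pos.1 him
  refine hRH ρ hz ?_ ?_
  · rintro ⟨k, hk⟩
    apply him0
    rw [hk]
    simp
  · intro h
    apply him0
    simp [h]

/-- Basic facts on a box zero: `ρ ≠ 0`, `ρ ≠ 1`, `m(ρ) ≥ 0` (indeed `> 0`). -/
theorem mem_liZeroBox_aux {T : ℝ} {ρ : ℂ} (hρ : ρ ∈ liZeroBox T) :
    ρ ≠ 0 ∧ ρ ≠ 1 ∧ (0 : ℝ) ≤ riemannZetaZeroOrder ρ ∧ 0 ≤ ρ.re := by
  obtain ⟨hz, h0, -, him, -⟩ := hρ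
  have him0 : ρ.im ≠ 0 := abs_pos.1 him
  have hρ1 : ρ ≠ 1 := fun h ↦ him0 (by simp [h])
  have hρ0 : ρ ≠ 0 := fun h ↦ him0 (by simp [h])
  refine ⟨hρ0, hρ1, ?_, h0⟩
  exact_mod_cast ((riemannZetaZeroOrder_pos_iff hρ1).2 hz).le

/-- `Re Λ₁(T) = Σ m(ρ) · Re ρ / |ρ|²` (termwise `≥ 0`, no RH). -/
theorem re_boxSum_one_eq (T : ℝ) :
    ((∑ ρ ∈ (liZeroBox_finite T).toFinset, (riemannZetaZeroOrder ρ : ℂ) * (1 - (1 - 1 / ρ) ^ 1))).re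
      = ∑ ρ ∈ (liZeroBox_finite T).toFinset,
          (riemannZetaZeroOrder ρ : ℝ) * (ρ.re / Complex.normSq ρ) := by
  rw [Complex.re_sum]
  refine Finset.sum_congr rfl fun ρ _ ↦ ?_
  have e1 : (1 : ℂ) - (1 - 1 / ρ) ^ 1 = ρ⁻¹ := by ring
  rw [e1, Complex.mul_re, Complex.intCast_re, Complex.intCast_im, zero_mul, sub_zero,
    Complex.inv_re]

/-- `T ↦ Re Λ₁(T)` is non-decreasing (nested boxes, non-negative terms). -/
theorem re_boxSum_one_mono : Monotone fun T : ℝ ↦ ((∑ ρ ∈ (liZeroBox_finite T).toFinset, (riemannZetaZeroOrder ρ : ℂ) * (1 - (1 - 1 / ρ) ^ 1))).re := by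
  intro T T' hTT'
  simp only [re_boxSum_one_eq]
  apply Finset.sum_le_sum_of_subset_of_nonneg
  · intro ρ hρ
    rw [Set.Finite.mem_toFinset] at hρ ⊢
    obtain ⟨a, b, c, d, e⟩ := hρ
    exact ⟨a, b, c, d, e.trans hTT'⟩
  · intro ρ hρ _
    have hρ' : ρ ∈ liZeroBox T' := (Set.Finite.mem_toFinset _).1 hρ
    obtain ⟨-, -, hm, h0⟩ := mem_liZeroBox_aux hρ'
    exact mul_nonneg hm (div_nonneg h0 (Complex.normSq_nonneg _))

/-- `Re Λ₁(T) ≤ λ₁` for every `T`. -/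
theorem re_boxSum_one_le (T : ℝ) : ((∑ ρ ∈ (liZeroBox_finite T).toFinset, (riemannZetaZeroOrder ρ : ℂ) * (1 - (1 - 1 / ρ) ^ 1))).re ≤ keiperLiCoeff 1 := by
  have h' : Tendsto (fun T : ℝ ↦ ((∑ ρ ∈ (liZeroBox_finite T).toFinset, (riemannZetaZeroOrder ρ : ℂ) * (1 - (1 - 1 / ρ) ^ 1))).re)
      atTop (𝓝 (keiperLiCoeff 1)) := by
    have := (Complex.continuous_re.tendsto _).comp (tendsto_boxSum (n := 1) le_rfl)
    simp only [Complex.ofReal_re] at this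
    exact this
  exact re_boxSum_one_mono.ge_of_tendsto h' T

/-- Under RH: `‖Λ_{n+2}(T) − 2Λ_{n+1}(T) + Λ_n(T)‖ ≤ 2 Re Λ₁(T)`. -/
theorem norm_secondDiff_boxSum_le (hRH : RiemannHypothesis) (n : ℕ) (T : ℝ) :
    ‖(∑ ρ ∈ (liZeroBox_finite T).toFinset, (riemannZetaZeroOrder ρ : ℂ) * (1 - (1 - 1 / ρ) ^ (n + 2)))
        - 2 * (∑ ρ ∈ (liZeroBox_finite T).toFinset, (riemannZetaZeroOrder ρ : ℂ) * (1 - (1 - 1 / ρ) ^ (n + 1)))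
        + (∑ ρ ∈ (liZeroBox_finite T).toFinset, (riemannZetaZeroOrder ρ : ℂ) * (1 - (1 - 1 / ρ) ^ n))‖
        ≤ 2 * ((∑ ρ ∈ (liZeroBox_finite T).toFinset, (riemannZetaZeroOrder ρ : ℂ) * (1 - (1 - 1 / ρ) ^ 1))).re := by
  rw [boxSum_secondDiff, norm_neg, re_boxSum_one_eq, Finset.mul_sum]
  refine (norm_sum_le _ _).trans (Finset.sum_le_sum fun ρ hρ ↦ ?_)
  have hρ' : ρ ∈ liZeroBox T := (Set.Finite.mem_toFinset _).1 hρ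
  have hre := re_eq_half_of_mem_liZeroBox hRH hρ'
  obtain ⟨hρ0, -, hm, -⟩ := mem_liZeroBox_aux hρ'
  have hz1 : ‖(1 : ℂ) - 1 / ρ‖ = 1 := norm_one_sub_inv_eq_one hre
  have hns : ‖ρ‖ ^ 2 = Complex.normSq ρ := Complex.sq_norm ρ
  have hpos : 0 < Complex.normSq ρ := Complex.normSq_pos.2 hρ0
  rw [norm_div, norm_mul, norm_pow, hz1, one_pow, mul_one, Complex.norm_intCast, norm_pow, hns,
    hre, abs_of_nonneg hm]
  rw [div_le_iff₀ hpos]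
  have : 2 * ((riemannZetaZeroOrder ρ : ℝ) * (1 / 2 / Complex.normSq ρ)) * Complex.normSq ρ
      = (riemannZetaZeroOrder ρ : ℝ) := by
    field_simp
  rw [this]

/-- **Xiao 2020, Cor. 3.3 (kernel).** Under RH, `|λ_{n+2} − 2λ_{n+1} + λ_n| ≤ 2λ₁` for every `n ≥ 1`. -/
theorem abs_liSecondDiff_le_of_rh (hRH : Summit.RiemannHypothesis) {n : ℕ} (hn : 1 ≤ n) :
    |(keiperLiCoeff (n + 2) - 2 * keiperLiCoeff (n + 1) + keiperLiCoeff n)| ≤ 2 * keiperLiCoeff 1 := by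
  have hRH' : RiemannHypothesis := hRH
  have hlim : Tendsto (fun T : ℝ ↦ (∑ ρ ∈ (liZeroBox_finite T).toFinset, (riemannZetaZeroOrder ρ : ℂ) * (1 - (1 - 1 / ρ) ^ (n + 2)))
      - 2 * (∑ ρ ∈ (liZeroBox_finite T).toFinset, (riemannZetaZeroOrder ρ : ℂ) * (1 - (1 - 1 / ρ) ^ (n + 1)))
      + (∑ ρ ∈ (liZeroBox_finite T).toFinset, (riemannZetaZeroOrder ρ : ℂ) * (1 - (1 - 1 / ρ) ^ n)))
      atTop
      (𝓝 ((keiperLiCoeff (n + 2) : ℂ) - 2 * (keiperLiCoeff (n + 1) : ℂ) + (keiperLiCoeff n : ℂ))) :=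
    ((tendsto_boxSum (n := n + 2) (by omega)).sub
      ((tendsto_boxSum (n := n + 1) (by omega)).const_mul 2)).add (tendsto_boxSum hn)
  have hnorm := (continuous_norm.tendsto _).comp hlim
  have hle : ∀ T : ℝ, ‖(∑ ρ ∈ (liZeroBox_finite T).toFinset, (riemannZetaZeroOrder ρ : ℂ) * (1 - (1 - 1 / ρ) ^ (n + 2)))
      - 2 * (∑ ρ ∈ (liZeroBox_finite T).toFinset, (riemannZetaZeroOrder ρ : ℂ) * (1 - (1 - 1 / ρ) ^ (n + 1)))
      + (∑ ρ ∈ (liZeroBox_finite T).toFinset, (riemannZetaZeroOrder ρ : ℂ) * (1 - (1 - 1 / ρ) ^ n))‖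
      ≤ 2 * keiperLiCoeff 1 :=
    fun T ↦ (norm_secondDiff_boxSum_le hRH' n T).trans (by linarith [re_boxSum_one_le T])
  have H : ‖(keiperLiCoeff (n + 2) : ℂ) - 2 * (keiperLiCoeff (n + 1) : ℂ) + (keiperLiCoeff n : ℂ)‖
      ≤ 2 * keiperLiCoeff 1 :=
    le_of_tendsto' hnorm fun T ↦ by simpa only [Function.comp_apply] using hle T
  have e : (keiperLiCoeff (n + 2) : ℂ) - 2 * (keiperLiCoeff (n + 1) : ℂ) + (keiperLiCoeff n : ℂ)
      = (((keiperLiCoeff (n + 2) - 2 * keiperLiCoeff (n + 1) + keiperLiCoeff n) : ℝ) : ℂ) := by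
    push_cast; ring
  rw [e, Complex.norm_real, Real.norm_eq_abs] at H
  exact H

/-- The constant in closed form: `2λ₁ = 2 + γ − log 4π` (`keiperLiCoeff_one_eq`). -/
theorem two_mul_keiperLiCoeff_one :
    2 * keiperLiCoeff 1 = 2 + Real.eulerMascheroniConstant - Real.log (4 * Real.pi) := by
  rw [keiperLiCoeff_one_eq, show (4 : ℝ) * Real.pi = 2 * 2 * Real.pi by ring,
    Real.log_mul (by norm_num) Real.pi_pos.ne', Real.log_mul (by norm_num) (by norm_num)]
  ring

/-- Xiao's form with the explicit constant. -/
theorem abs_liSecondDiff_le_of_rh' (hRH : Summit.RiemannHypothesis) {n : ℕ} (hn : 1 ≤ n) :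
    |keiperLiCoeff (n + 2) - 2 * keiperLiCoeff (n + 1) + keiperLiCoeff n|
      ≤ 2 + Real.eulerMascheroniConstant - Real.log (4 * Real.pi) := by
  rw [← two_mul_keiperLiCoeff_one]
  exact abs_liSecondDiff_le_of_rh hRH hn

/-! ## §2 The converse: one-sided floors on `d_n` ⟹ RH; the curvature criterion and the gap theorem -/

/-- **Second-difference criterion, either sign.** A sub-exponential one-sided floor
`σ·d_n ≥ −C(ε)e^{εn}` (all `ε > 0`, all large `n`) implies RH (double telescoping onto the tree's
increment criterion `rh_of_liIncrFloor`). -/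
theorem rh_of_liSecondDiffFloor {σ : ℝ} (hσ : σ = 1 ∨ σ = -1)
    (h : ∀ ε : ℝ, 0 < ε → ∃ C : ℝ, ∃ n₀ : ℕ, ∀ n : ℕ, n₀ ≤ n →
      -C * Real.exp (ε * n) ≤ σ * (keiperLiCoeff (n + 2) - 2 * keiperLiCoeff (n + 1) + keiperLiCoeff n)) : Summit.RiemannHypothesis := by
  refine rh_of_liIncrFloor hσ
    (floor_of_incrFloor (x := fun n ↦ σ * (keiperLiCoeff (n + 1) - keiperLiCoeff n)) fun ε hε ↦ ?_)
  obtain ⟨C, n₀, hn₀⟩ := h ε hε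
  refine ⟨C, n₀, fun n hn ↦ ?_⟩
  have h1 := hn₀ n hn
  have e : σ * (keiperLiCoeff (n + 2) - 2 * keiperLiCoeff (n + 1) + keiperLiCoeff n)
      = σ * (keiperLiCoeff (n + 1 + 1) - keiperLiCoeff (n + 1))
        - σ * (keiperLiCoeff (n + 1) - keiperLiCoeff n) := by
    simp only [show n + 1 + 1 = n + 2 by omega]; ring
  show -C * Real.exp (ε * n)
    ≤ σ * (keiperLiCoeff (n + 1 + 1) - keiperLiCoeff (n + 1)) - σ * (keiperLiCoeff (n + 1) - keiperLiCoeff n)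
  linarith

/-- `d_n` bounded BELOW by a constant (from some `n` on) ⟹ RH. -/
theorem rh_of_liSecondDiff_bddBelow (h : ∃ C : ℝ, ∃ n₀ : ℕ, ∀ n : ℕ, n₀ ≤ n → -C ≤ (keiperLiCoeff (n + 2) - 2 * keiperLiCoeff (n + 1) + keiperLiCoeff n)) :
    Summit.RiemannHypothesis := by
  obtain ⟨C, n₀, hC⟩ := h
  refine rh_of_liSecondDiffFloor (σ := 1) (Or.inl rfl) fun ε hε ↦ ⟨|C|, n₀, fun n hn ↦ ?_⟩
  have hexp : 1 ≤ Real.exp (ε * n) := Real.one_le_exp (by positivity)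
  have := hC n hn
  rw [one_mul]
  nlinarith [abs_nonneg C, le_abs_self C]

/-- `d_n` bounded ABOVE by a constant (from some `n` on) ⟹ RH. -/
theorem rh_of_liSecondDiff_bddAbove (h : ∃ C : ℝ, ∃ n₀ : ℕ, ∀ n : ℕ, n₀ ≤ n → (keiperLiCoeff (n + 2) - 2 * keiperLiCoeff (n + 1) + keiperLiCoeff n) ≤ C) :
    Summit.RiemannHypothesis := by
  obtain ⟨C, n₀, hC⟩ := h
  refine rh_of_liSecondDiffFloor (σ := -1) (Or.inr rfl) fun ε hε ↦ ⟨|C|, n₀, fun n hn ↦ ?_⟩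
  have hexp : 1 ≤ Real.exp (ε * n) := Real.one_le_exp (by positivity)
  have := hC n hn
  nlinarith [abs_nonneg C, le_abs_self C]

/-- **The curvature criterion (second-order Li criterion).**
`RH ⟺ |λ_{n+2} − 2λ_{n+1} + λ_n| ≤ 2λ₁` for all `n ≥ 1`. -/
theorem rh_iff_abs_liSecondDiff_le :
    Summit.RiemannHypothesis ↔ ∀ n : ℕ, 1 ≤ n → |(keiperLiCoeff (n + 2) - 2 * keiperLiCoeff (n + 1) + keiperLiCoeff n)| ≤ 2 * keiperLiCoeff 1 := by
  refine ⟨fun hRH n hn ↦ abs_liSecondDiff_le_of_rh hRH hn, fun h ↦ ?_⟩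
  refine rh_of_liSecondDiff_bddBelow ⟨2 * keiperLiCoeff 1, 1, fun n hn ↦ ?_⟩
  exact (abs_le.1 (h n hn)).1

/-- `RH ⟺ d_n` bounded below (eventually). -/
theorem rh_iff_liSecondDiff_bddBelow :
    Summit.RiemannHypothesis ↔ ∃ C : ℝ, ∃ n₀ : ℕ, ∀ n : ℕ, n₀ ≤ n → -C ≤ (keiperLiCoeff (n + 2) - 2 * keiperLiCoeff (n + 1) + keiperLiCoeff n) := by
  refine ⟨fun hRH ↦ ⟨2 * keiperLiCoeff 1, 1, fun n hn ↦ ?_⟩, rh_of_liSecondDiff_bddBelow⟩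
  exact (abs_le.1 (abs_liSecondDiff_le_of_rh hRH hn)).1

/-- `RH ⟺ d_n` bounded above (eventually). -/
theorem rh_iff_liSecondDiff_bddAbove :
    Summit.RiemannHypothesis ↔ ∃ C : ℝ, ∃ n₀ : ℕ, ∀ n : ℕ, n₀ ≤ n → (keiperLiCoeff (n + 2) - 2 * keiperLiCoeff (n + 1) + keiperLiCoeff n) ≤ C := by
  refine ⟨fun hRH ↦ ⟨2 * keiperLiCoeff 1, 1, fun n hn ↦ ?_⟩, rh_of_liSecondDiff_bddAbove⟩
  exact (abs_le.1 (abs_liSecondDiff_le_of_rh hRH hn)).2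

/-- **Gap theorem (RH-free).** Either `|d_n| ≤ 2λ₁` for every `n ≥ 1`, or `(d_n)` is unbounded
below AND unbounded above along `n ≥ n₀` for every `n₀`: `sup_n |d_n| ∈ [0, 2λ₁] ∪ {+∞}`. -/
theorem liSecondDiff_dichotomy :
    (∀ n : ℕ, 1 ≤ n → |(keiperLiCoeff (n + 2) - 2 * keiperLiCoeff (n + 1) + keiperLiCoeff n)| ≤ 2 * keiperLiCoeff 1) ∨
      ((∀ C : ℝ, ∀ n₀ : ℕ, ∃ n : ℕ, n₀ ≤ n ∧ (keiperLiCoeff (n + 2) - 2 * keiperLiCoeff (n + 1) + keiperLiCoeff n) < -C) ∧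
        (∀ C : ℝ, ∀ n₀ : ℕ, ∃ n : ℕ, n₀ ≤ n ∧ C < (keiperLiCoeff (n + 2) - 2 * keiperLiCoeff (n + 1) + keiperLiCoeff n))) := by
  by_cases hRH : Summit.RiemannHypothesis
  · exact Or.inl (rh_iff_abs_liSecondDiff_le.1 hRH)
  · refine Or.inr ⟨fun C n₀ ↦ ?_, fun C n₀ ↦ ?_⟩
    · by_contra hcon
      push Not at hcon
      exact hRH (rh_of_liSecondDiff_bddBelow ⟨C, n₀, hcon⟩)
    · by_contra hcon
      push Not at hcon
      exact hRH (rh_of_liSecondDiff_bddAbove ⟨C, n₀, hcon⟩)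

/-! ## §3 Under RH the increments are `2λ₁`-Lipschitz -/

/-- Under RH, `|Δ_m − Δ_n| ≤ 2λ₁ (m − n)` for `1 ≤ n ≤ m` (`Δ_k = λ_{k+1} − λ_k`). -/
theorem abs_liIncr_sub_liIncr_le_of_rh (hRH : Summit.RiemannHypothesis) {n m : ℕ} (hn : 1 ≤ n)
    (hnm : n ≤ m) : |(keiperLiCoeff (m + 1) - keiperLiCoeff m) - (keiperLiCoeff (n + 1) - keiperLiCoeff n)| ≤ 2 * keiperLiCoeff 1 * (m - n) := by
  obtain ⟨k, rfl⟩ := Nat.exists_eq_add_of_le hnm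
  induction k with
  | zero => simp
  | succ k ih =>
    have h1 := ih (by omega)
    have h2 := abs_liSecondDiff_le_of_rh hRH (n := n + k) (by omega)
    rw [show n + (k + 1) = n + k + 1 by omega, show n + k + 1 + 1 = n + k + 2 by omega]
    have e : keiperLiCoeff (n + k + 2) - keiperLiCoeff (n + k + 1) - (keiperLiCoeff (n + 1) - keiperLiCoeff n)
        = (keiperLiCoeff (n + k + 2) - 2 * keiperLiCoeff (n + k + 1) + keiperLiCoeff (n + k))
          + ((keiperLiCoeff (n + k + 1) - keiperLiCoeff (n + k))
            - (keiperLiCoeff (n + 1) - keiperLiCoeff n)) := by ring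
    rw [e]
    refine (abs_add_le _ _).trans ?_
    push_cast
    push_cast at h1
    nlinarith

/-- In particular an exception `Δ_n < 0` (`n ≥ 1`) forces `Δ_m ≤ 2λ₁ (m − n)` for all `m ≥ n` and
`Δ_m ≤ 2λ₁ (n − m)` for `1 ≤ m ≤ n`: exceptions sit inside runs of sub-mean increments. -/
theorem liIncr_le_of_exception (hRH : Summit.RiemannHypothesis) {n m : ℕ} (hn : 1 ≤ n) (hm : 1 ≤ m)
    (hexc : (keiperLiCoeff (n + 1) - keiperLiCoeff n) < 0) : (keiperLiCoeff (m + 1) - keiperLiCoeff m) ≤ 2 * keiperLiCoeff 1 * |(m : ℝ) - n| := by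
  rcases le_total n m with hnm | hmn
  · have h := abs_liIncr_sub_liIncr_le_of_rh hRH hn hnm
    have hcast : (n : ℝ) ≤ m := by exact_mod_cast hnm
    rw [abs_of_nonneg (by linarith : (0 : ℝ) ≤ (m : ℝ) - n)]
    have := (abs_le.1 h).2
    linarith
  · have h := abs_liIncr_sub_liIncr_le_of_rh hRH hm hmn
    have hcast : (m : ℝ) ≤ n := by exact_mod_cast hmn
    rw [abs_sub_comm, abs_of_nonneg (by linarith : (0 : ℝ) ≤ (n : ℝ) - m)]
    have := (abs_le.1 h).1
    linarith

end Summit.RiemannHypothesis.RiemannHypothesis.Theorems.Splittings.LiSecondOrderCriterion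

end
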